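import Mathlib
import HarnessLib

/-!
# CAP Instance A (cell pub-adcap) — a priori unstable pendulum–rotator with explicit `ε`: the certified diffusing-orbit CLAIM (statement level)

CITATION HEADER (lean-in-tree rule, cell pub-adcap, 2026-08-18). This module TYPES — it does not prove — the exact
statement that a computer-assisted certificate for Instance A of the cell pub-adcap establishes: for a concrete
Hamiltonian vector field with an EXPLICIT perturbation interval, an orbit starting in an explicit box changes its
action `I` by an explicit amount within an explicit time. It is the house "certificate pattern": the system is a
literal vector field, the numbers are the fields of a `Certificate` record, and the claim is a `Prop`; the record
`certA` (with the sha256 of the certificate file it summarises) is landed by the numerics seats in a SEPARATE file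
once TWO independent implementations agree, and nothing here asserts it. NO theorem in this file claims diffusion.

The model is the a priori unstable "generalized Arnold example" of Delshams–de la Llave–Seara, Chapter 13,
eq. (13.1) [cite: DelshamsDelallaveSeara2006, Ch. 13 (13.1)], with the two-harmonic coupling `g(φ, t) = cos φ + cos t`
studied by Delshams–Huguet, Nonlinearity 22 (2009) 1997, and Delshams–Schaefer, RCD 22 (2017) 78 ("complete family"):

  `H_ε(φ, I, q, p, t) = I²/2 + p²/2 + (cos q − 1) + ε · cos q · (cos φ + cos t)`,   `(φ, q, t) ∈ 𝕋³`, `(I, p) ∈ ℝ²`.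

At `ε = 0` the cylinder `Λ̃ = {p = q = 0}` is normally hyperbolic (pendulum saddle) and `I` is conserved; for `ε ≠ 0`
`Λ̃` survives literally (`p = q = 0 ⇒ ṗ = q̇ = 0`) but the perturbation does not vanish on it (large-gap problem,
[cite: DelshamsDelallaveSeara2006, p. 128]). Angles are tracked on the universal cover `ℝ` (the vector field is
`2π`-periodic in `φ`, `q`, `t`), so no quotient is needed for the statement.

Prior art the certificate must go beyond (HOME/FRESHNESS.md v1, P1): Capiński–Gonzalez–Marco–Mireles James, CNSNS 106
(2022) 105970, prove drift for a standard-map × rotator MAP with `ε` EXISTENTIAL ("there exists an ε > 0", Thm 24);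
here `ε` ranges over an explicit closed interval `[epsLo, epsHi]` with `epsLo > 0`, the system is a Hamiltonian
FLOW, and the drift `deltaI` is a stated number of order one.

PLACEMENT: the cell brief named `Summits/ArnoldDiffusion/CAP/`; no such summit exists and the gate's target grammar admits only
`Statement` / `Theorems` under `Summits/`, so the shape lives here as tracked Literature vocabulary (the model IS published:
DLS 2006 (13.1)); the certificate record and its landing file follow the same path.

What is deliberately NOT here: the flow map (Mathlib has no ODE flow object we would want to depend on — a solution
is a curve `γ` with `HasDerivAt γ (X ε t (γ t)) t` for all `t`), any transversality / NHIM / windows vocabulary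
(that is the certificate's business, audited in HOME/REFEREE.md), and any numerical value.
-/

noncomputable section

open Set

namespace Literature.Dynamics.Hamiltonian.ArnoldDiffusionCAP.InstanceA

/-- Phase point `(φ, I, q, p) ∈ ℝ⁴` on the universal cover: index `0 = φ` (rotator angle), `1 = I` (rotator
action, the diffusing variable), `2 = q` (pendulum angle), `3 = p` (pendulum momentum). [folklore] -/
abbrev Pt := Fin 4 → ℝ

/-- The Hamiltonian `H_ε(φ, I, q, p, t) = I²/2 + p²/2 + (cos q − 1) + ε cos q (cos φ + cos t)`
[cite: DelshamsDelallaveSeara2006, Ch. 13 (13.1)] with `g(φ, t) = cos φ + cos t`. -/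
def hamiltonian (ε t : ℝ) (x : Pt) : ℝ :=
  (x 1) ^ 2 / 2 + (x 3) ^ 2 / 2 + (Real.cos (x 2) - 1) + ε * Real.cos (x 2) * (Real.cos (x 0) + Real.cos t)

/-- Hamilton's equations of `hamiltonian` as an explicit non-autonomous vector field on `ℝ⁴`:
`φ' = I`, `I' = ε cos q sin φ`, `q' = p`, `p' = sin q · (1 + ε (cos φ + cos t))`.
[cite: DelshamsDelallaveSeara2006, Ch. 13 (13.1)] -/
def vectorField (ε t : ℝ) (x : Pt) : Pt :=
  ![x 1,
    ε * Real.cos (x 2) * Real.sin (x 0),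
    x 3,
    Real.sin (x 2) * (1 + ε * (Real.cos (x 0) + Real.cos t))]

/-- `γ : ℝ → ℝ⁴` is a (global, classical) solution of the Instance-A system at parameter `ε`. [folklore] -/
def IsSolution (ε : ℝ) (γ : ℝ → Pt) : Prop :=
  ∀ t : ℝ, HasDerivAt γ (vectorField ε t (γ t)) t

/-- The DATA a certificate summarises. `epsLo ≤ ε ≤ epsHi` is the certified perturbation interval; `boxLo i ≤ x i
≤ boxHi i` is the initial box (on the cover); `deltaI` the certified action change; `timeBound` the certified time in
which it happens; `sha256` the hex digest of the certificate file (`HOME/certs/instanceA/…`) the record was read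
from. No field has a default: a record with `epsLo ≤ 0` or `deltaI ≤ 0` makes `Claim` FALSE, not vacuous
(see `Claim`). [folklore] -/
structure Certificate where
  epsLo : ℝ
  epsHi : ℝ
  boxLo : Pt
  boxHi : Pt
  deltaI : ℝ
  timeBound : ℝ
  sha256 : String

/-- The initial box of a certificate, as a subset of `ℝ⁴`. [folklore] -/
def Certificate.box (c : Certificate) : Set Pt := {x | ∀ i, c.boxLo i ≤ x i ∧ x i ≤ c.boxHi i}

/-- THE CLAIM of an Instance-A certificate `c` (statement level; nothing asserts it here):
`0 < epsLo ≤ epsHi`, `0 < deltaI`, and for EVERY `ε ∈ [epsLo, epsHi]` there is a solution `γ` of the system starting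
in the box whose action `I = γ(·) 1` increases by at least `deltaI` at some time `T ∈ [0, timeBound]`.
The two side conditions rule out the junk values (empty `ε`-interval, non-positive drift) that would make the
existential part free. Time-`2π`-map or Poincaré-section formulations used by the certificate must be discharged
INTO this flow statement by the landing file. [folklore] -/
def Claim (c : Certificate) : Prop :=
  0 < c.epsLo ∧ c.epsLo ≤ c.epsHi ∧ 0 < c.deltaI ∧
  ∀ ε ∈ Icc c.epsLo c.epsHi, ∃ γ : ℝ → Pt, IsSolution ε γ ∧ γ 0 ∈ c.box ∧
    ∃ T ∈ Icc (0 : ℝ) c.timeBound, c.deltaI ≤ γ T 1 - γ 0 1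

/-- The ITINERARY form (Capiński–Gidea shape, [cite: CapinskiGidea2021, Thm 1(2)]): for every `ε` in the interval and
every finite sequence of target actions in `[aLo, aHi]` separated by more than `2·res`, one solution from the box
visits them in order within `res`. Recorded for a certificate that validates the symbolic-dynamics strengthening;
the drift `Claim` is what Instance A promises. [folklore] -/
def ItineraryClaim (c : Certificate) (aLo aHi res : ℝ) : Prop :=
  0 < c.epsLo ∧ c.epsLo ≤ c.epsHi ∧ 0 < res ∧ aLo + 2 * res < aHi ∧
  ∀ ε ∈ Icc c.epsLo c.epsHi, ∀ (L : ℕ) (a : Fin (L + 1) → ℝ),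
    (∀ l, a l ∈ Icc aLo aHi) → (∀ l : Fin L, 2 * res < |a l.succ - a l.castSucc|) →
    ∃ γ : ℝ → Pt, IsSolution ε γ ∧ γ 0 ∈ c.box ∧
      ∃ T : Fin (L + 1) → ℝ, StrictMono T ∧ 0 ≤ T 0 ∧ ∀ l, |γ (T l) 1 - a l| < res

/-- Sanity: `Λ̃ = {q = p = 0}` is invariant for every `ε`, `t` — the vector field is tangent to it (its `q`- and
`p`-components vanish there). This is the a priori unstable feature of the model [cite: DelshamsDelallaveSeara2006,
p. 128] and is the only thing PROVED in this file. [cite: DelshamsDelallaveSeara2006, Ch. 13] -/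
theorem vectorField_tangent_saddleCylinder (ε t : ℝ) (x : Pt) (hq : x 2 = 0) (hp : x 3 = 0) :
    vectorField ε t x 2 = 0 ∧ vectorField ε t x 3 = 0 := by
  simp [vectorField, hq, hp]

/-- Sanity: a certificate whose claim holds has a non-empty positive `ε`-interval (no vacuity). [folklore] -/
theorem Claim.epsLo_pos {c : Certificate} (h : Claim c) : 0 < c.epsLo := h.1

/-- Sanity: a certificate whose claim holds certifies a strictly positive drift (no vacuity). [folklore] -/
theorem Claim.deltaI_pos {c : Certificate} (h : Claim c) : 0 < c.deltaI := h.2.2.1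

end Literature.Dynamics.Hamiltonian.ArnoldDiffusionCAP.InstanceA
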